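import Summits.QuantumFields.BalabanUV.Beta.WindingIncrement

/-!
# Beta / WindingWords — THE CERTIFICATE INTERFACE «winding by compass words» for the (W) hypotheses of THEOREM DB
# (β sub-cell, BINDER-OWNERS row CAP-k, lineage `b2b-balaban-beta-an5`, gen 23; node BETA-an5-g23-THEOREM-DB, leaf 1b; journal CLAIM l.14161)

What a one-dimensional winding certificate must deliver to the kernel (companion of `Beta.WindingIncrement`, whose `IsContLog` ∕
`incr_eq` currency it instantiates): a partition `x 0 ≤ x 1 ≤ … ≤ x n` of the window and directions `θ j` (one per segment) with
the LEAF FACTS `0 < Re (e^{−iθ_j} φ u)` for `u ∈ [x j, x (j+1)]` — sign conditions on validated enclosures of `φ` (for quarter-turn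
words `θ j ∈ (π/2)ℤ` they read `±Re φ > 0` ∕ `±Im φ > 0`) — and consecutive direction steps `|θ (j+1) − θ j| < π`.  THEN a
continuous logarithm of `φ` EXISTS on `[x 0, x n]` with the CLOSED-FORM increment
`(log (e^{−iθ_{n−1}} φ (x n)) + iθ_{n−1}) − (log (e^{−iθ_0} φ (x 0)) + iθ_0)` (`isContLog_of_word`: consecutive rotated principal
logarithms agree at the nodes, `log_rotate_eq`), and for a CLOSED word (`φ (x n) = φ (x 0)`, `θ (n−1) = θ 0 + 2πk`) EVERY continuous
logarithm has increment EXACTLY `2πk·I` (`incr_eq_of_closed_word`): the winding number of the window is the net number of quarter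
turns of the certified direction word divided by four — an integer count, no transcendental evaluation in the kernel.

HONEST FRAMING.  Kernel glue ([folklore]); no number of the β-function, no binder instance, no certificate for the cell's `k₀`.
Discharging `BetaPertH` would make Bałaban's ultraviolet stability unconditional — NOT the continuum limit, NOT the Clay problem.
0 `sorry`, 0 cite tags.
-/

namespace Summit.QuantumFields.BalabanUV.Beta.WindingWords

open Complex Set Metric
open Summit.QuantumFields.BalabanUV.Beta.WindingIncrement
open scoped Real

noncomputable section

/-! ## Winding by compass words -/

/-- THE NODE IDENTITY: if `v` lies in the two open half-planes `Re (e^{−iα} v) > 0`, `Re (e^{−iβ} v) > 0` with `|β − α| < π`, the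
two rotated principal logarithms agree: `log (e^{−iα} v) + iα = log (e^{−iβ} v) + iβ`. [folklore] -/
theorem log_rotate_eq {v : ℂ} {α β : ℝ} (hα : 0 < (exp (-(α * I)) * v).re) (hβ : 0 < (exp (-(β * I)) * v).re)
    (hαβ : |β - α| < π) : log (exp (-(α * I)) * v) + α * I = log (exp (-(β * I)) * v) + β * I := by
  set a := exp (-(α * I)) * v with ha
  set b := exp (-(β * I)) * v with hb
  have ha0 : a ≠ 0 := fun h => by rw [h, zero_re] at hα; exact lt_irrefl _ hα
  have hb0 : b ≠ 0 := fun h => by rw [h, zero_re] at hβ; exact lt_irrefl _ hβ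
  have hexpA : exp (log a + α * I) = v := by
    rw [exp_add, exp_log ha0, ha, mul_comm (exp _) v, mul_assoc, ← exp_add]; simp
  have hexpB : exp (log b + β * I) = v := by
    rw [exp_add, exp_log hb0, hb, mul_comm (exp _) v, mul_assoc, ← exp_add]; simp
  have hexp : exp ((log a + α * I) - (log b + β * I)) = 1 := by
    rw [exp_sub, hexpA, hexpB, div_self]
    intro hv; rw [hv, mul_zero] at ha; exact ha0 ha
  have harga : |arg a| < π / 2 := abs_arg_lt_pi_div_two_iff.mpr (Or.inl hα)
  have hargb : |arg b| < π / 2 := abs_arg_lt_pi_div_two_iff.mpr (Or.inl hβ)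
  have him : |((log a + α * I) - (log b + β * I)).im| < 2 * π := by
    have e : ((log a + α * I) - (log b + β * I)).im = (arg a - arg b) + (α - β) := by
      simp [log_im]; ring
    rw [e]
    have h1 := abs_sub (arg a) (arg b)
    have h2 : |α - β| < π := by rw [abs_sub_comm]; exact hαβ
    calc |(arg a - arg b) + (α - β)| ≤ |arg a - arg b| + |α - β| := abs_add_le _ _
      _ < (π / 2 + π / 2) + π := by linarith
      _ = 2 * π := by ring
  have e := eq_zero_of_exp_eq_one_of_abs_im_lt hexp him
  rw [sub_eq_zero] at e
  exact e

/-- monotonicity of a node sequence along a prefix. [folklore] -/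
theorem node_mono {x : ℕ → ℝ} {n : ℕ} (hx : ∀ j < n, x j ≤ x (j + 1)) {i j : ℕ} (hij : i ≤ j) (hjn : j ≤ n) :
    x i ≤ x j := by
  induction j with
  | zero => rw [Nat.le_zero.mp hij]
  | succ j ih =>
    rcases Nat.lt_or_eq_of_le hij with h | h
    · exact (ih (Nat.lt_succ_iff.mp h) (Nat.le_of_succ_le hjn)).trans (hx j (Nat.lt_of_succ_le hjn))
    · rw [h]

/-- one certified segment: on `[s, t]` with `0 < Re (e^{−iθ} φ)`, the rotated principal logarithm `log (e^{−iθ} φ) + iθ` is a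
continuous logarithm of `φ`. [folklore] -/
theorem isContLog_segment {φ : ℝ → ℂ} {s t θ : ℝ} (hφ : ContinuousOn φ (Icc s t))
    (hleaf : ∀ u ∈ Icc s t, 0 < (exp (-(θ * I)) * φ u).re) :
    IsContLog φ s t (fun u => log (exp (-(θ * I)) * φ u) + θ * I) where
  cont := ((continuousOn_const.mul hφ).clog fun u hu => mem_slitPlane_iff.mpr (Or.inl (hleaf u hu))).add
    continuousOn_const
  exp_eq u hu := by
    have h0 : exp (-(θ * I)) * φ u ≠ 0 := fun h => by
      have := hleaf u hu; rw [h, zero_re] at this; exact lt_irrefl _ this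
    rw [exp_add, exp_log h0, mul_comm (exp _) (φ u), mul_assoc, ← exp_add]; simp

/-- **WINDING BY COMPASS WORDS — EXISTENCE WITH A CLOSED-FORM INCREMENT.**  Data: nodes `x 0 ≤ x 1 ≤ … ≤ x n` (`0 < n`) and
directions `θ 0, …, θ (n−1)` with consecutive steps `|θ (j+1) − θ j| < π`; LEAF FACTS: `0 < Re (e^{−iθ_j} φ u)` for
`u ∈ [x j, x (j+1)]`.  THEN `φ` has a continuous logarithm on `[x 0, x n]` whose increment is
`(log (e^{−iθ_{n−1}} φ (x n)) + iθ_{n−1}) − (log (e^{−iθ_0} φ (x 0)) + iθ_0)` (induction on the word; consecutive rotated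
logarithms agree at the nodes by `log_rotate_eq`). [folklore] -/
theorem isContLog_of_word {φ : ℝ → ℂ} (x θ : ℕ → ℝ) :
    ∀ n : ℕ, 0 < n → (∀ j < n, x j ≤ x (j + 1)) → ContinuousOn φ (Icc (x 0) (x n)) →
      (∀ j, j + 1 < n → |θ (j + 1) - θ j| < π) →
      (∀ j < n, ∀ u ∈ Icc (x j) (x (j + 1)), 0 < (exp (-(θ j * I)) * φ u).re) →
      ∃ L, IsContLog φ (x 0) (x n) L ∧
        L (x n) - L (x 0) = (log (exp (-(θ (n - 1) * I)) * φ (x n)) + θ (n - 1) * I)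
          - (log (exp (-(θ 0 * I)) * φ (x 0)) + θ 0 * I) := by
  intro n hn
  induction n with
  | zero => exact absurd hn (lt_irrefl 0)
  | succ n ih =>
    intro hx hφ hθ hleaf
    by_cases hn0 : n = 0
    · subst hn0
      refine ⟨_, isContLog_segment hφ (hleaf 0 Nat.zero_lt_one), ?_⟩
      simp
    have hnpos : 0 < n := Nat.pos_of_ne_zero hn0
    -- the word on the first `n` segments
    have hx' : ∀ j < n, x j ≤ x (j + 1) := fun j hj => hx j (Nat.lt_succ_of_lt hj)
    have h0n : x 0 ≤ x n := node_mono hx (Nat.zero_le n) (Nat.le_succ n)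
    have hnn1 : x n ≤ x (n + 1) := hx n (Nat.lt_succ_self n)
    obtain ⟨L, hL, hincr⟩ := ih hnpos hx' (hφ.mono (Icc_subset_Icc le_rfl hnn1))
      (fun j hj => hθ j (Nat.lt_succ_of_lt hj)) (fun j hj => hleaf j (Nat.lt_succ_of_lt hj))
    -- the last segment, shifted to match at the node `x n`
    set c : ℂ := L (x n) - (log (exp (-(θ n * I)) * φ (x n)) + θ n * I) with hc
    have hseg := isContLog_segment (hφ.mono (Icc_subset_Icc h0n le_rfl)) (hleaf n (Nat.lt_succ_self n))
    have hexpc : exp c = 1 := by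
      rw [hc, exp_sub, hL.exp_eq (x n) ⟨h0n, le_rfl⟩, hseg.exp_eq (x n) ⟨le_rfl, hnn1⟩, div_self]
      exact hL.ne_zero ⟨h0n, le_rfl⟩
    have hM := hseg.add_const_of_exp_eq_one hexpc
    have hglue := hL.glue hM (by simp only [hc]; ring)
    refine ⟨_, hglue, ?_⟩
    -- the node identity at `x n` between directions `θ (n-1)` and `θ n`
    have hnode : log (exp (-(θ (n - 1) * I)) * φ (x n)) + θ (n - 1) * I
        = log (exp (-(θ n * I)) * φ (x n)) + θ n * I := by
      refine log_rotate_eq ?_ ?_ ?_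
      · have hmem : x n ∈ Icc (x (n - 1)) (x (n - 1 + 1)) := by
          have h1 := hx' (n - 1) (Nat.sub_lt hnpos Nat.one_pos)
          rw [Nat.sub_add_cancel hnpos] at h1 ⊢
          exact ⟨h1, le_rfl⟩
        exact hleaf (n - 1) (by omega) (x n) hmem
      · exact hleaf n (Nat.lt_succ_self n) (x n) ⟨le_rfl, hnn1⟩
      · have := hθ (n - 1) (by omega)
        rwa [Nat.sub_add_cancel hnpos] at this
    -- evaluate the glued logarithm at both ends
    have eTop : (if x (n + 1) ≤ x n then L (x (n + 1)) else log (exp (-(θ n * I)) * φ (x (n + 1))) + θ n * I + c)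
        = log (exp (-(θ n * I)) * φ (x (n + 1))) + θ n * I + c := by
      by_cases h : x (n + 1) ≤ x n
      · have e : x (n + 1) = x n := le_antisymm h hnn1
        simp only [e, le_refl, if_true, hc]; ring
      · simp only [h, if_false]
    have eBot : (if x 0 ≤ x n then L (x 0) else log (exp (-(θ n * I)) * φ (x 0)) + θ n * I + c) = L (x 0) := by
      simp only [h0n, if_true]
    rw [eTop, eBot, Nat.add_sub_cancel]
    have e2 : log (exp (-(θ n * I)) * φ (x (n + 1))) + θ n * I + c - L (x 0)
        = (log (exp (-(θ n * I)) * φ (x (n + 1))) + θ n * I) + (L (x n) - L (x 0))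
          - (log (exp (-(θ n * I)) * φ (x n)) + θ n * I) := by rw [hc]; ring
    rw [e2, hincr, hnode]; ring

/-- **CLOSED COMPASS WORDS**: if in addition the word is CLOSED — `φ (x n) = φ (x 0)` and `θ (n−1) = θ 0 + 2πk` — then EVERY
continuous logarithm of `φ` on `[x 0, x n]` has increment EXACTLY `2πk·I`: the winding number over the window is the integer `k`,
read off the direction word (for quarter-turn words `θ j ∈ (π/2)ℤ`: net quarter turns ∕ 4). [folklore] -/
theorem incr_eq_of_closed_word {φ : ℝ → ℂ} (x θ : ℕ → ℝ) {n : ℕ} (hn : 0 < n) (hx : ∀ j < n, x j ≤ x (j + 1))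
    (hφ : ContinuousOn φ (Icc (x 0) (x n))) (hθ : ∀ j, j + 1 < n → |θ (j + 1) - θ j| < π)
    (hleaf : ∀ j < n, ∀ u ∈ Icc (x j) (x (j + 1)), 0 < (exp (-(θ j * I)) * φ u).re)
    (hper : φ (x n) = φ (x 0)) {k : ℤ} (hclosed : θ (n - 1) = θ 0 + k * (2 * π))
    {M : ℝ → ℂ} (hM : IsContLog φ (x 0) (x n) M) : M (x n) - M (x 0) = k * (2 * π * I) := by
  obtain ⟨L, hL, hincr⟩ := isContLog_of_word x θ n hn hx hφ hθ hleaf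
  have h0n : x 0 ≤ x n := node_mono hx (Nat.zero_le n) le_rfl
  rw [hM.incr_eq hL h0n, hincr, hper, hclosed]
  have e : exp (-((((θ 0 : ℝ) : ℂ) + (k : ℂ) * (2 * (π : ℂ))) * I)) = exp (-(θ 0 * I)) := by
    rw [show -((((θ 0 : ℝ) : ℂ) + (k : ℂ) * (2 * (π : ℂ))) * I) = -((θ 0 : ℂ) * I) + ((-k : ℤ) : ℂ) * (2 * π * I) by
      push_cast; ring, exp_add, exp_int_mul_two_pi_mul_I, mul_one]
  push_cast
  rw [e]; ring

/-- the existence half alone: a certified word gives a continuous logarithm (no closedness needed). [folklore] -/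
theorem exists_isContLog_of_word {φ : ℝ → ℂ} (x θ : ℕ → ℝ) {n : ℕ} (hn : 0 < n) (hx : ∀ j < n, x j ≤ x (j + 1))
    (hφ : ContinuousOn φ (Icc (x 0) (x n))) (hθ : ∀ j, j + 1 < n → |θ (j + 1) - θ j| < π)
    (hleaf : ∀ j < n, ∀ u ∈ Icc (x j) (x (j + 1)), 0 < (exp (-(θ j * I)) * φ u).re) :
    ∃ L, IsContLog φ (x 0) (x n) L :=
  let ⟨L, hL, _⟩ := isContLog_of_word x θ n hn hx hφ hθ hleaf
  ⟨L, hL⟩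

end

end Summit.QuantumFields.BalabanUV.Beta.WindingWords
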